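import Mathlib
import Summits.Ventures.HodgeRepro2.T5N2DatumExistence
import Summits.Ventures.HodgeRepro2.CyclotomicSeven
import Summits.Ventures.HodgeRepro2.T6N2Main

/-!
# T6N2Toy — non-vacuity witnesses for the N2 datum type and for `N2_main` (README §10.5(ii)(c)/(d);
owner t6-p5)

(c) The carrier `N2Datum F P 𝒟` is inhabited for every `(F, P, 𝒟)` over every degree-6 CM field, by
a REAL instance: the CM frame `τ`, the μ-admissible sign elements `e₁₁₁`, `e₁₀₀` and the similitude
scalar `u` of p3's existence theorem `T5N2DatumExistence.exists_lemma_N2_complete` (p402183 — a CM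
frame exists on a sextic CM field, every CM type admits a Liu sign element by weak approximation,
and `lemma_N2_complete` supplies `u`), the trivial character group `Unit`, and the admissible
Schwartz sets `Set.univ`. (d) On this instance the binders of `N2_main` hold jointly: `IsCMFrame τ`,
the two admissibilities and the sign specification `USpec` of `u` are the existence theorem's
conjuncts, so `MuAdmissible` and `HChi` hold outright (`toyDatum_muAdmissible`, `toyDatum_hChi`)
and `Adm` — including the isometry `W_B ≅ W_A` — holds GIVEN the one display
(`toyDatum_adm (hSh) : (toyDatum h6).Adm`): the display `Hyp.Shimura2008_Thm2_2_i K` is Landherr's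
classification for the field `K` itself (a statement about ALL rank-2 forms over `K`), not a
property of the datum, and is therefore not instantiated on a toy — §10.5(ii)(d) is reported as
«joint modulo that one display». The concrete field: `K7 = ℚ(ζ₇)` (p1's `CyclotomicSeven`:
`finrank_K7`, `isCMField_K7`), `toyDatumK7`.

README §8(d): uses an L-value-free non-vanishing device: NO (TIER5 §N2, a pre-02:16Z line of
record — N2 asserts no non-vanishing — continued).
-/

namespace Summit.Ventures.HodgeRepro2.T6.N2Toy

open Summit.Ventures.HodgeRepro2
open Summit.Ventures.HodgeRepro2.T5DatumSimilitude
open Summit.Ventures.HodgeRepro2.T5CubeTypes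
open Summit.Ventures.HodgeRepro2.CyclotomicSeven

variable {K : Type*} [Field K] [NumberField K] [NumberField.IsCMField K]

/-- THE EXISTENCE OF A TOY DATUM with the binders of `N2_main` jointly satisfied, on any degree-6
CM field: frame, sign elements and `u` from p3's `exists_lemma_N2_complete`; `Char := Unit`;
admissible sets `Set.univ`. -/
theorem exists_toyDatum (h6 : Module.finrank ℚ K = 6) (F : FaceSetting K) (P : NDatum F)
    (𝒟 : N3Datum) :
    ∃ D : N2Datum F P 𝒟, IsCMFrame D.τ ∧ IsLiuSignElement K (D.type t111) D.e₁₁₁ ∧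
      IsLiuSignElement K (D.type t100) D.e₁₀₀ ∧ N2Main.USpec D ∧
      D.admA = Set.univ ∧ D.admB = Set.univ ∧ D.admC = Set.univ ∧ D.admD = Set.univ := by
  obtain ⟨τ, e₁, e₂, hfr, h₁, h₂, u, hu1, hu2, -, -, -, hu6, -⟩ :=
    T5N2DatumExistence.exists_lemma_N2_complete (K := K) h6
  refine ⟨N2Datum.mk τ e₁ e₂ u Unit () () Set.univ Set.univ Set.univ Set.univ,
    hfr, h₁, h₂, ⟨hu1, hu2, hu6⟩, rfl, rfl, rfl, rfl⟩

/-- The toy datum (chosen from `exists_toyDatum`). -/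
noncomputable def toyDatum (h6 : Module.finrank ℚ K = 6) (F : FaceSetting K) (P : NDatum F)
    (𝒟 : N3Datum) : N2Datum F P 𝒟 :=
  Classical.choose (exists_toyDatum h6 F P 𝒟)

/-- The toy datum's specification: a CM frame, the two admissibilities, `USpec`, and the
admissible sets `Set.univ`. -/
theorem toyDatum_spec (h6 : Module.finrank ℚ K = 6) (F : FaceSetting K) (P : NDatum F)
    (𝒟 : N3Datum) :
    IsCMFrame (toyDatum h6 F P 𝒟).τ ∧
      IsLiuSignElement K ((toyDatum h6 F P 𝒟).type t111) (toyDatum h6 F P 𝒟).e₁₁₁ ∧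
      IsLiuSignElement K ((toyDatum h6 F P 𝒟).type t100) (toyDatum h6 F P 𝒟).e₁₀₀ ∧
      N2Main.USpec (toyDatum h6 F P 𝒟) ∧
      (toyDatum h6 F P 𝒟).admA = Set.univ ∧ (toyDatum h6 F P 𝒟).admB = Set.univ ∧
      (toyDatum h6 F P 𝒟).admC = Set.univ ∧ (toyDatum h6 F P 𝒟).admD = Set.univ :=
  Classical.choose_spec (exists_toyDatum h6 F P 𝒟)

/-- (c): the carrier is inhabited. -/
theorem nonempty_n2Datum (h6 : Module.finrank ℚ K = 6) (F : FaceSetting K) (P : NDatum F)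
    (𝒟 : N3Datum) : Nonempty (N2Datum F P 𝒟) :=
  ⟨toyDatum h6 F P 𝒟⟩

/-- (b1) on the toy: the four sign elements are μ-admissible. -/
theorem toyDatum_muAdmissible (h6 : Module.finrank ℚ K = 6) (F : FaceSetting K) (P : NDatum F)
    (𝒟 : N3Datum) : (toyDatum h6 F P 𝒟).MuAdmissible :=
  let s := toyDatum_spec h6 F P 𝒟
  N2Main.muAdmissible_of _ s.1 s.2.1 s.2.2.1 s.2.2.2.1

/-- (b3) on the toy: (H_χ). -/
theorem toyDatum_hChi (h6 : Module.finrank ℚ K = 6) (F : FaceSetting K) (P : NDatum F)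
    (𝒟 : N3Datum) : (toyDatum h6 F P 𝒟).HChi :=
  N2Main.hChi _

/-- Every Schwartz quadruple is admissible data on the toy (`admA = … = Set.univ`). -/
theorem toyDatum_admData (h6 : Module.finrank ℚ K = 6) (F : FaceSetting K) (P : NDatum F)
    (𝒟 : N3Datum) (φ : 𝒟.A.Sa × 𝒟.A.Sb × 𝒟.B.Sa × 𝒟.B.Sb) : (toyDatum h6 F P 𝒟).AdmData φ := by
  obtain ⟨-, -, -, -, hA, hB, hC, hD⟩ := toyDatum_spec h6 F P 𝒟
  exact ⟨by rw [hA]; trivial, by rw [hB]; trivial, by rw [hC]; trivial, by rw [hD]; trivial⟩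

/-- (d) for `N2_main`: every binder of `N2_main` is instantiated on the toy — the four datum
binders by the existence theorem, and `N2_main`'s conclusion `Adm` follows from the one display
(Landherr's classification for `K`, not a property of the datum: reported «joint modulo that
display»). -/
theorem toyDatum_adm (h6 : Module.finrank ℚ K = 6) (F : FaceSetting K) (P : NDatum F)
    (𝒟 : N3Datum) (hSh : Hyp.Shimura2008_Thm2_2_i K) : (toyDatum h6 F P 𝒟).Adm :=
  let s := toyDatum_spec h6 F P 𝒟
  N2Main.adm_of _ s.1 s.2.1 s.2.2.1 s.2.2.2.1 hSh

/-! ### The concrete field `ℚ(ζ₇)` -/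

/-- The toy datum over `K7 = ℚ(ζ₇)` (p1's `CyclotomicSeven`: sextic, CM). -/
noncomputable def toyDatumK7 (F : FaceSetting K7) (P : NDatum F) (𝒟 : N3Datum) : N2Datum F P 𝒟 :=
  toyDatum finrank_K7 F P 𝒟

/-- On `ℚ(ζ₇)`: the four sign elements are μ-admissible and (H_χ) holds. -/
theorem toyDatumK7_muAdmissible_hChi (F : FaceSetting K7) (P : NDatum F) (𝒟 : N3Datum) :
    (toyDatumK7 F P 𝒟).MuAdmissible ∧ (toyDatumK7 F P 𝒟).HChi :=
  ⟨toyDatum_muAdmissible finrank_K7 F P 𝒟, toyDatum_hChi finrank_K7 F P 𝒟⟩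

/-- On `ℚ(ζ₇)`: `Adm` from the one display. -/
theorem toyDatumK7_adm (F : FaceSetting K7) (P : NDatum F) (𝒟 : N3Datum)
    (hSh : Hyp.Shimura2008_Thm2_2_i K7) : (toyDatumK7 F P 𝒟).Adm :=
  toyDatum_adm finrank_K7 F P 𝒟 hSh

end Summit.Ventures.HodgeRepro2.T6.N2Toy
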